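import Literature.Computability.AlgebraicComplexity.BD17DescartesCircuitsProofs
import Mathlib.Analysis.Analytic.Order
import Mathlib.Analysis.Calculus.LocalExtr.Rolle
import Mathlib.Topology.Order.IntermediateValue
import Mathlib.Order.Interval.Set.Infinite
import Mathlib.Data.List.Sort
import HarnessLib

/-!
# Roots counted with multiplicity: Rolle's theorem with multiplicities, sign variations
# (tools for Pólya–Szegő V 87–90 = Bihan–Dickenstein 2017, Prop. 4.2)

THEOREMS ONLY (no definitions, no named facts); second of three proof files discharging the named
fact `BD2017_prop_4_2` of `BD17DescartesSystemsWronskians.lean` (Bihan–Dickenstein 2017, Prop. 4.2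
= Pólya–Szegő, *Problems and Theorems in Analysis II*, Part V, problems 87 and 90). The source
proof (Part V §7, solutions 87–90, pp. 226–227 of the 1998 printing, held text
`book:polya1998-problems-theorems-analysis-ii-theory-functions-zeros` p0240–p0241) uses, besides
the Wronskian identities of `BD17WronskianIdentities.lean`:

* "[12]" = Rolle's theorem in the form `Z* ≥ Z − 1` for the numbers of zeros, COUNTED WITH
  MULTIPLICITY, of a function and of its derivative on an open interval (Part V problem 12) —
  here `BD17.finite_zeros_and_rootCountMult_le_deriv_add_one` for real analytic functions, with
  multiplicity = order of vanishing (`analyticOrderNatAt`, as in `BD17.rootCountMult`);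
* "[Look at multiple zeros!]" (problem 87): a function whose derivatives of orders `< ℓ` vanish at
  `y₀` has there a zero of multiplicity `≥ ℓ` — `BD17.le_rootCountMult_of_iteratedDeriv_eq_zero`;
* "[3]" = elementary facts on the number of sign changes `Var` (Part V problems 1–3): a sequence
  with `Var = 0` is one-signed (`BD17.forall_nonneg_or_forall_nonpos_of_signVar_eq_zero`), a
  sequence of length `m+1` with `Var ≥ m` alternates strictly
  (`BD17.mul_succ_neg_of_le_signVar`), inserting zeros does not change `Var`
  (`BD17.signVar_ofFn_extend`), and the bookkeeping identity turning the coefficient sequence of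
  solution 90 into the list form of BD 2017 Lemma 4.4 (`BD17.ofFn_transform_eq_negTake_append_drop`);
* the restriction of Descartes' rule to a subfamily (`BD17.satisfiesDescartesRule_comp_strictMono`,
  used in solution 87: "cf. (1)" applied to subsystems).

Cell `val-lit`, row X4-BD17 (LADDER-VALIANT V1 ideation source). Honest framing: textbook real
analysis; nothing here bears on VP versus VNP.

## References

* [PolyaSzego1998] G. Pólya, G. Szegő, *Problems and Theorems in Analysis II*, Springer Classics
  in Mathematics (1998 printing), doi:10.1007/978-3-642-61905-2: Part V §1 problems 1–3, 12;
  §7 problems 87–90 with solutions.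
* [BihanDickenstein2017] F. Bihan, A. Dickenstein, IMRN 2017 (22) 6867–6893; arXiv:1601.05826,
  §4.1 Def. 4.1, Prop. 4.2.
-/

noncomputable section

open Set Filter Topology Finset
open Literature.Algebra.Polynomial (signVar signVarAux)

namespace Literature.Computability.AlgebraicComplexity

namespace BD17

/-! ### Sign variations: one-signed and alternating sequences (Pólya–Szegő V 1–3) -/

/-- The recursion for two leading nonzero entries. [cite: BasuPollackRoy2006, Notation 2.32] -/
theorem signVar_cons_cons_of_ne_zero {a b : ℝ} (ha : a ≠ 0) (hb : b ≠ 0) (l : List ℝ) :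
    signVar (a :: b :: l) = (if a * b < 0 then 1 else 0) + signVar (b :: l) := by
  simp [Literature.Algebra.Polynomial.signVar, ha, hb, signVarAux]

/-- A list of nonzero reals without sign changes is one-signed (pairwise positive products).
[cite: PolyaSzego1998, Part V §1 problem 1] -/
theorem mul_pos_of_signVarAux_eq_zero :
    ∀ (l : List ℝ), (∀ x ∈ l, x ≠ 0) → signVarAux l = 0 → ∀ x ∈ l, ∀ x' ∈ l, 0 < x * x'
  | [], _, _ => by simp
  | [a], h, _ => by
      intro x hx x' hx'
      simp only [List.mem_singleton] at hx hx'
      rw [hx, hx']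
      exact mul_self_pos.mpr (h a (by simp))
  | a :: b :: l, h, h0 => by
      have hrec : signVarAux (a :: b :: l) = (if a * b < 0 then 1 else 0) + signVarAux (b :: l) :=
        rfl
      rw [hrec] at h0
      have hab : ¬ a * b < 0 := by
        intro hlt
        simp [hlt] at h0
      have h0' : signVarAux (b :: l) = 0 := by simpa [hab] using h0
      have IH := mul_pos_of_signVarAux_eq_zero (b :: l) (fun x hx => h x (by simp [hx])) h0'
      have ha : a ≠ 0 := h a (by simp)
      have hb : b ≠ 0 := h b (by simp)
      have hab' : 0 < a * b := lt_of_le_of_ne (not_lt.mp hab) (mul_ne_zero ha hb).symm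
      have key : ∀ z ∈ a :: b :: l, 0 < z * b := by
        intro z hz
        rcases List.mem_cons.mp hz with rfl | hz
        · exact hab'
        · exact IH z hz b (by simp)
      intro x hx x' hx'
      have h1 := key x hx
      have h2 := key x' hx'
      have hbb : 0 < b * b := mul_self_pos.mpr hb
      have : 0 < (x * x') * (b * b) := by
        calc (0 : ℝ) < x * b * (x' * b) := mul_pos h1 h2
          _ = (x * x') * (b * b) := by ring
      rcases pos_and_pos_or_neg_and_neg_of_mul_pos this with ⟨h3, _⟩ | ⟨_, h4⟩
      · exact h3
      · exact absurd h4 (not_lt.mpr hbb.le)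

/-- **Pólya–Szegő V 1–3:** a sequence with no change of sign is one-signed: all entries `≥ 0` or
all entries `≤ 0`. [cite: PolyaSzego1998, Part V §1 problem 1] -/
theorem forall_nonneg_or_forall_nonpos_of_signVar_eq_zero (l : List ℝ) (h : signVar l = 0) :
    (∀ x ∈ l, 0 ≤ x) ∨ (∀ x ∈ l, x ≤ 0) := by
  have hm : ∀ x ∈ l.filter (fun a => a ≠ 0), x ≠ 0 := by
    intro x hx
    simpa using (List.mem_filter.mp hx).2
  have hpos := mul_pos_of_signVarAux_eq_zero _ hm h
  have hmem : ∀ x ∈ l, x ≠ 0 → x ∈ l.filter (fun a => a ≠ 0) := fun x hx hx0 =>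
    List.mem_filter.mpr ⟨hx, by simpa using hx0⟩
  by_cases hall : ∀ x ∈ l, x = 0
  · left
    intro x hx
    rw [hall x hx]
  · push Not at hall
    obtain ⟨z, hzl, hz0⟩ := hall
    have hz := hmem z hzl hz0
    rcases lt_or_gt_of_ne hz0 with hzneg | hzpos
    · right
      intro x hx
      by_cases hx0 : x = 0
      · rw [hx0]
      · have := hpos x (hmem x hx hx0) z hz
        nlinarith
    · left
      intro x hx
      by_cases hx0 : x = 0
      · rw [hx0]
      · have := hpos x (hmem x hx hx0) z hz
        nlinarith

/-- **Pólya–Szegő V 1–3:** a sequence of `m + 1` reals with at least (hence exactly) `m` changes of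
sign has no zero entry and alternates strictly in sign. [cite: PolyaSzego1998, Part V §1 problem 3] -/
theorem mul_succ_neg_of_le_signVar :
    ∀ (m : ℕ) (a : Fin (m + 1) → ℝ), m ≤ signVar (List.ofFn a) →
      ∀ j : Fin m, a j.castSucc * a j.succ < 0
  | 0, _, _ => fun j => j.elim0
  | m + 1, a, hm => by
      have hlen : ∀ {k : ℕ} (c : Fin k → ℝ), signVar (List.ofFn c) ≤ k - 1 := by
        intro k c
        simpa using signVar_le_length_sub_one (List.ofFn c)
      have hcons : List.ofFn a = a 0 :: List.ofFn (fun i : Fin (m + 1) => a i.succ) :=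
        List.ofFn_succ
      have ha0 : a 0 ≠ 0 := by
        intro h0
        rw [hcons, h0] at hm
        have : signVar ((0 : ℝ) :: List.ofFn (fun i : Fin (m + 1) => a i.succ)) =
            signVar (List.ofFn (fun i : Fin (m + 1) => a i.succ)) := by
          simp [Literature.Algebra.Polynomial.signVar]
        rw [this] at hm
        have := hlen (fun i : Fin (m + 1) => a i.succ)
        omega
      have hcons2 : List.ofFn (fun i : Fin (m + 1) => a i.succ) =
          a (0 : Fin (m + 1)).succ :: List.ofFn (fun i : Fin m => a i.succ.succ) := List.ofFn_succ
      have ha1 : a (0 : Fin (m + 1)).succ ≠ 0 := by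
        intro h1
        rw [hcons, hcons2, h1] at hm
        have : signVar (a 0 :: (0 : ℝ) :: List.ofFn (fun i : Fin m => a i.succ.succ)) =
            signVar (a 0 :: List.ofFn (fun i : Fin m => a i.succ.succ)) := by
          simp [Literature.Algebra.Polynomial.signVar, ha0]
        rw [this] at hm
        have h' := signVar_le_length_sub_one (a 0 :: List.ofFn (fun i : Fin m => a i.succ.succ))
        simp only [List.length_cons, List.length_ofFn] at h'
        omega
      have hrec : signVar (List.ofFn a) = (if a 0 * a (0 : Fin (m + 1)).succ < 0 then 1 else 0) +
          signVar (List.ofFn (fun i : Fin (m + 1) => a i.succ)) := by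
        rw [hcons, hcons2, signVar_cons_cons_of_ne_zero ha0 ha1]
      have htl_le := hlen (fun i : Fin (m + 1) => a i.succ)
      have h01 : a 0 * a (0 : Fin (m + 1)).succ < 0 := by
        by_contra hnot
        rw [hrec, if_neg hnot] at hm
        omega
      have htl_ge : m ≤ signVar (List.ofFn (fun i : Fin (m + 1) => a i.succ)) := by
        rw [hrec, if_pos h01] at hm
        omega
      have IH := mul_succ_neg_of_le_signVar m (fun i : Fin (m + 1) => a i.succ) htl_ge
      intro j
      refine Fin.cases ?_ (fun j' => ?_) j
      · simpa using h01
      · have := IH j'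
        simpa only [Fin.succ_castSucc] using this

/-! ### Sign variations of a subfamily extended by zeros -/

/-- Inserting zero coefficients (at the places outside an increasing subfamily) does not change
the number of sign changes (zeros are dropped, Part V problem 1).
[cite: PolyaSzego1998, Part V §1 problem 1] -/
theorem signVar_ofFn_extend {s ℓ : ℕ} (J : Fin ℓ → Fin s) (hJ : StrictMono J) (c : Fin ℓ → ℝ) :
    signVar (List.ofFn (Function.extend J c (fun _ => (0 : ℝ)))) = signVar (List.ofFn c) := by
  classical
  unfold Literature.Algebra.Polynomial.signVar
  congr 1
  set a : Fin s → ℝ := Function.extend J c (fun _ => (0 : ℝ)) with ha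
  have haJ : ∀ b, a (J b) = c b := fun b => hJ.injective.extend_apply c (fun _ => (0 : ℝ)) b
  have ha0 : ∀ i, (¬ ∃ b, J b = i) → a i = 0 := fun i hi => by
    simp only [ha, Function.extend_apply' _ _ _ hi]
  rw [List.ofFn_eq_map, List.ofFn_eq_map, List.filter_map, List.filter_map]
  have hidx : (List.finRange s).filter ((fun x : ℝ => decide (x ≠ 0)) ∘ a) =
      ((List.finRange ℓ).filter ((fun x : ℝ => decide (x ≠ 0)) ∘ c)).map J := by
    apply List.Pairwise.eq_of_mem_iff (r := (· < ·))
    · exact (List.sortedLT_iff_pairwise.mp (List.sortedLT_finRange s)).filter _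
    · rw [List.pairwise_map]
      exact ((List.sortedLT_iff_pairwise.mp (List.sortedLT_finRange ℓ)).filter _).imp
        (fun hab => hJ hab)
    · intro i
      simp only [List.mem_filter, List.mem_finRange, true_and, Function.comp_apply,
        decide_eq_true_eq, List.mem_map]
      constructor
      · intro hi
        by_cases hex : ∃ b, J b = i
        · obtain ⟨b, rfl⟩ := hex
          exact ⟨b, by simpa [haJ] using hi, rfl⟩
        · exact absurd (ha0 i hex) hi
      · rintro ⟨b, hb, rfl⟩
        simpa [haJ] using hb
  rw [hidx, List.map_map]
  congr 1
  funext b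
  exact haJ b

/-! ### The coefficient sequence of solution 90 in the list form of BD 2017, Lemma 4.4 -/

/-- The sequence `−a_0, …, −a_{q−1}, a_{q+1}, …, a_t` of Pólya–Szegő solution 90 (indices `≠ q`
enumerated by `q.succAbove`, sign `−1` below `q`) is the list
`(−c_0, …, −c_{q−1}, c_{q+1}, …)` of BD 2017, Lemma 4.4. [cite: PolyaSzego1998, Part V §7 solution 90] -/
theorem ofFn_transform_eq_negTake_append_drop {t : ℕ} (a : Fin (t + 1) → ℝ) (q : Fin (t + 1)) :
    List.ofFn (fun j : Fin t => (if (Fin.castSucc j) < q then (-1 : ℝ) else 1) * a (q.succAbove j)) =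
      ((List.ofFn a).take q).map (fun c => -c) ++ (List.ofFn a).drop (q + 1) := by
  apply List.ext_getElem
  · simp only [List.length_ofFn, List.length_append, List.length_map, List.length_take,
      List.length_drop]
    have := q.isLt
    omega
  · intro i h1 h2
    simp only [List.length_ofFn] at h1
    rw [List.getElem_ofFn]
    have hq := q.isLt
    by_cases hi : i < q.val
    · have hlt : Fin.castSucc (⟨i, h1⟩ : Fin t) < q := by
        rw [Fin.lt_def]; simpa using hi
      rw [if_pos hlt, Fin.succAbove_of_castSucc_lt _ _ hlt]
      have hlen : i < (((List.ofFn a).take q).map (fun c => -c)).length := by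
        simp only [List.length_map, List.length_take, List.length_ofFn]; omega
      rw [List.getElem_append_left hlen]
      simp only [List.getElem_map, List.getElem_take, List.getElem_ofFn, neg_one_mul,
        Fin.castSucc_mk]
    · have hge : ¬ Fin.castSucc (⟨i, h1⟩ : Fin t) < q := by
        rw [Fin.lt_def]; simpa using hi
      rw [if_neg hge, Fin.succAbove_of_le_castSucc _ _ (not_lt.mp hge), one_mul]
      have hlen : (((List.ofFn a).take q).map (fun c => -c)).length ≤ i := by
        simp only [List.length_map, List.length_take, List.length_ofFn]; omega
      rw [List.getElem_append_right hlen]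
      simp only [List.length_map, List.length_take, List.length_ofFn, List.getElem_drop,
        List.getElem_ofFn, Fin.succ_mk]
      congr 1
      ext
      simp only []
      omega

/-! ### Roots counted with multiplicity (`BD17.rootCountMult`) -/

/-- An analytic function with finitely many zeros in an open set containing `y₀` has finite order
at `y₀`. [cite: BihanDickenstein2017, Def. 4.1] -/
theorem analyticOrderAt_ne_top_of_finite_zeros {f : ℝ → ℝ} {Δ : Set ℝ} (hΔ : IsOpen Δ) {y₀ : ℝ}
    (hy₀ : y₀ ∈ Δ) (hfin : {y | y ∈ Δ ∧ f y = 0}.Finite) : analyticOrderAt f y₀ ≠ ⊤ := by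
  intro htop
  rw [analyticOrderAt_eq_top] at htop
  have hev : ∀ᶠ y in 𝓝 y₀, y ∈ Δ ∧ f y = 0 := (hΔ.eventually_mem hy₀).and htop
  obtain ⟨ε, hε, hball⟩ := Metric.mem_nhds_iff.mp hev
  apply (Set.Ioo_infinite (show y₀ - ε < y₀ + ε by linarith)).mono _ |>.elim
  · exact hfin
  · intro y hy
    have : y ∈ Metric.ball y₀ ε := by rwa [Real.ball_eq_Ioo]
    exact hball this

/-- The zero set in an open set `Δ` and the count with multiplicity only depend on the function on
`Δ`. [cite: BihanDickenstein2017, Def. 4.1] -/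
theorem rootCountMult_congr_of_eqOn {f g : ℝ → ℝ} {Δ : Set ℝ} (hΔ : IsOpen Δ) (hfg : Set.EqOn f g Δ) :
    {y | y ∈ Δ ∧ f y = 0} = {y | y ∈ Δ ∧ g y = 0} ∧ rootCountMult f Δ = rootCountMult g Δ := by
  have hset : {y | y ∈ Δ ∧ f y = 0} = {y | y ∈ Δ ∧ g y = 0} := by
    ext y
    simp only [Set.mem_setOf_eq]
    constructor
    · rintro ⟨hy, h0⟩; exact ⟨hy, by rwa [← hfg hy]⟩
    · rintro ⟨hy, h0⟩; exact ⟨hy, by rwa [hfg hy]⟩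
  refine ⟨hset, ?_⟩
  unfold rootCountMult
  rw [hset]
  refine finsum_mem_congr rfl fun y hy => ?_
  exact congrArg ENat.toNat
    (analyticOrderAt_congr (Filter.eventually_of_mem (hΔ.mem_nhds hy.1) hfg))

/-- Multiplying by a nonvanishing analytic function changes neither the zeros nor their
multiplicities. [cite: PolyaSzego1998, Part V §7 solution 90] -/
theorem rootCountMult_mul_left_eq {f g : ℝ → ℝ} {Δ : Set ℝ}
    (hf : AnalyticOnNhd ℝ f Δ) (hg : AnalyticOnNhd ℝ g Δ) (hg0 : ∀ y ∈ Δ, g y ≠ 0) :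
    {y | y ∈ Δ ∧ g y * f y = 0} = {y | y ∈ Δ ∧ f y = 0} ∧
      rootCountMult (fun y => g y * f y) Δ = rootCountMult f Δ := by
  have hset : {y | y ∈ Δ ∧ g y * f y = 0} = {y | y ∈ Δ ∧ f y = 0} := by
    ext y
    simp only [Set.mem_setOf_eq]
    constructor
    · rintro ⟨hy, h0⟩
      exact ⟨hy, (mul_eq_zero.mp h0).resolve_left (hg0 y hy)⟩
    · rintro ⟨hy, h0⟩
      exact ⟨hy, by rw [h0, mul_zero]⟩
  refine ⟨hset, ?_⟩
  unfold rootCountMult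
  rw [hset]
  refine finsum_mem_congr rfl fun y hy => ?_
  have hmul : analyticOrderAt (g * f) y = analyticOrderAt f y := by
    have := analyticOrderAt_mul (hg y hy.1) (hf y hy.1)
    rw [(hg y hy.1).analyticOrderAt_eq_zero.mpr (hg0 y hy.1), zero_add] at this
    exact this
  exact congrArg ENat.toNat hmul

/-- A zero of finite order at least `n` contributes at least `n` to the count with multiplicity
("[Look at multiple zeros!]", problem 87): if the derivatives of orders `< n` of the analytic `f`
vanish at `y₀ ∈ Δ` and `f` has finitely many zeros in `Δ`, then `n ≤` the number of roots of `f` in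
`Δ` counted with multiplicity. [cite: PolyaSzego1998, Part V §7 problem 87] -/
theorem le_rootCountMult_of_iteratedDeriv_eq_zero {f : ℝ → ℝ} {Δ : Set ℝ} (hΔ : IsOpen Δ)
    {y₀ : ℝ} (hy₀ : y₀ ∈ Δ) (hf : AnalyticAt ℝ f y₀) (hfin : {y | y ∈ Δ ∧ f y = 0}.Finite)
    {n : ℕ} (hn : 0 < n) (hder : ∀ i < n, iteratedDeriv i f y₀ = 0) : n ≤ rootCountMult f Δ := by
  have hne := analyticOrderAt_ne_top_of_finite_zeros hΔ hy₀ hfin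
  have hle : (n : ℕ∞) ≤ analyticOrderAt f y₀ :=
    (natCast_le_analyticOrderAt_iff_iteratedDeriv_eq_zero hf).mpr hder
  have hnat : n ≤ analyticOrderNatAt f y₀ := by
    rw [← Nat.cast_analyticOrderNatAt hne] at hle
    exact_mod_cast hle
  have hf0 : f y₀ = 0 := by simpa using hder 0 hn
  have hmem : y₀ ∈ hfin.toFinset := by
    rw [Set.Finite.mem_toFinset]
    exact ⟨hy₀, hf0⟩
  unfold rootCountMult
  rw [finsum_mem_eq_finite_toFinset_sum _ hfin]
  exact hnat.trans (Finset.single_le_sum (f := fun y => analyticOrderNatAt f y)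
    (fun _ _ => Nat.zero_le _) hmem)

/-! ### Rolle's theorem with multiplicities (Pólya–Szegő V 12) -/

/-- Between two zeros of a function continuous on `[a, b] ⊆ Δ` there is a zero of the derivative
in `Δ` (Rolle), packaged for the sorted enumeration of a finite set of zeros.
[cite: PolyaSzego1998, Part V §1 problem 12] -/
theorem exists_strictMono_deriv_zeros {G : ℝ → ℝ} {Δ : Set ℝ} (hΔc : IsPreconnected Δ)
    (hG : AnalyticOnNhd ℝ G Δ) {k : ℕ} (t : Fin (k + 1) → ℝ) (ht : StrictMono t)
    (htΔ : ∀ i, t i ∈ Δ) (ht0 : ∀ i, G (t i) = 0) :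
    ∃ c : Fin k → ℝ, StrictMono c ∧ (∀ i, c i ∈ Δ) ∧ (∀ i, deriv G (c i) = 0) ∧
      ∀ i, t i.castSucc < c i ∧ c i < t i.succ := by
  have hex : ∀ i : Fin k, ∃ c, c ∈ Set.Ioo (t i.castSucc) (t i.succ) ∧ deriv G c = 0 := by
    intro i
    have hlt : t i.castSucc < t i.succ := ht Fin.castSucc_lt_succ
    have hsub : Set.Icc (t i.castSucc) (t i.succ) ⊆ Δ := hΔc.Icc_subset (htΔ _) (htΔ _)
    have hcont : ContinuousOn G (Set.Icc (t i.castSucc) (t i.succ)) :=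
      fun y hy => (hG y (hsub hy)).continuousAt.continuousWithinAt
    obtain ⟨c, hc, hc0⟩ := exists_deriv_eq_zero hlt hcont (by rw [ht0, ht0])
    exact ⟨c, hc, hc0⟩
  choose c hc hc0 using hex
  refine ⟨c, ?_, ?_, hc0, fun i => ⟨(hc i).1, (hc i).2⟩⟩
  · intro i j hij
    calc c i < t i.succ := (hc i).2
      _ ≤ t j.castSucc := ht.monotone (by
          have := Fin.lt_def.mp hij
          rw [Fin.le_def, Fin.val_succ, Fin.val_castSucc]; exact this)
      _ < c j := (hc j).1
  · intro i
    exact hΔc.Icc_subset (htΔ _) (htΔ _) ⟨(hc i).1.le, (hc i).2.le⟩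

/-- **Rolle's theorem with multiplicities (Pólya–Szegő V 12)** for a real analytic function `G` on
an open interval `Δ`: if `G'` has finitely many zeros in `Δ`, then so has `G`, and the number of
zeros of `G` in `Δ` counted with multiplicity is at most one more than that of `G'`
(`Z* ≥ Z − 1` in solution 90). [cite: PolyaSzego1998, Part V §1 problem 12] -/
theorem finite_zeros_and_rootCountMult_le_deriv_add_one {G : ℝ → ℝ} {Δ : Set ℝ} (hΔ : IsOpen Δ)
    (hΔc : IsPreconnected Δ) (hG : AnalyticOnNhd ℝ G Δ)
    (hfin : {y | y ∈ Δ ∧ deriv G y = 0}.Finite) :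
    {y | y ∈ Δ ∧ G y = 0}.Finite ∧ rootCountMult G Δ ≤ rootCountMult (deriv G) Δ + 1 := by
  classical
  set Z' := {y | y ∈ Δ ∧ deriv G y = 0} with hZ'
  -- (1) any finite set of zeros of `G` in `Δ` has at most `#Z' + 1` elements
  have hbound : ∀ T : Finset ℝ, (∀ y ∈ T, y ∈ Δ ∧ G y = 0) → T.card ≤ hfin.toFinset.card + 1 := by
    intro T hT
    rcases Nat.eq_zero_or_pos T.card with h0 | hpos
    · omega
    obtain ⟨k, hk⟩ : ∃ k, T.card = k + 1 := ⟨T.card - 1, by omega⟩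
    set t : Fin (k + 1) → ℝ := fun i => T.orderEmbOfFin hk i with htdef
    have ht : StrictMono t := fun i j hij => (T.orderEmbOfFin hk).strictMono hij
    have htmem : ∀ i, t i ∈ T := fun i => T.orderEmbOfFin_mem hk i
    obtain ⟨c, hcmono, hcΔ, hc0, -⟩ := exists_strictMono_deriv_zeros hΔc hG t ht
      (fun i => (hT _ (htmem i)).1) (fun i => (hT _ (htmem i)).2)
    have hcmem : ∀ i, c i ∈ hfin.toFinset := fun i => by
      rw [Set.Finite.mem_toFinset]; exact ⟨hcΔ i, hc0 i⟩
    have hcard : (Finset.univ.image c).card ≤ hfin.toFinset.card :=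
      Finset.card_le_card (by
        intro x hx
        obtain ⟨i, -, rfl⟩ := Finset.mem_image.mp hx
        exact hcmem i)
    rw [Finset.card_image_of_injective _ hcmono.injective, Finset.card_univ, Fintype.card_fin]
      at hcard
    omega
  have hZfin : {y | y ∈ Δ ∧ G y = 0}.Finite := by
    by_contra hinf
    obtain ⟨T, hTsub, hTcard⟩ := Set.Infinite.exists_subset_card_eq hinf (hfin.toFinset.card + 2)
    have := hbound T (fun y hy => hTsub (Finset.mem_coe.mpr hy))
    omega
  refine ⟨hZfin, ?_⟩
  -- (2) the count with multiplicities
  set T := hZfin.toFinset with hTdef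
  have hT : ∀ y ∈ T, y ∈ Δ ∧ G y = 0 := fun y hy => by
    simpa [hTdef, Set.Finite.mem_toFinset] using hy
  -- orders
  have hordZ : ∀ y ∈ T, analyticOrderNatAt (deriv G) y + 1 = analyticOrderNatAt G y := by
    intro y hy
    have hyΔ := (hT y hy).1
    have hy0 := (hT y hy).2
    have hne : analyticOrderAt G y ≠ ⊤ := analyticOrderAt_ne_top_of_finite_zeros hΔ hyΔ hZfin
    have h1 := (hG y hyΔ).analyticOrderAt_deriv_add_one
    have h2 : analyticOrderAt (fun z => G z - G y) y = analyticOrderAt G y := by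
      simp [hy0]
    rw [h2] at h1
    have hne' : analyticOrderAt (deriv G) y ≠ ⊤ := by
      intro htop
      rw [htop] at h1
      exact hne (by simpa using h1.symm)
    have : ((analyticOrderNatAt (deriv G) y + 1 : ℕ) : ℕ∞) = (analyticOrderNatAt G y : ℕ∞) := by
      push_cast
      rw [Nat.cast_analyticOrderNatAt hne, Nat.cast_analyticOrderNatAt hne', h1]
    exact_mod_cast this
  rcases Nat.eq_zero_or_pos T.card with h0 | hpos
  · -- no zeros
    have hTe : T = ∅ := Finset.card_eq_zero.mp h0
    unfold rootCountMult
    rw [finsum_mem_eq_finite_toFinset_sum _ hZfin, ← hTdef, hTe]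
    simp
  obtain ⟨k, hk⟩ : ∃ k, T.card = k + 1 := ⟨T.card - 1, by omega⟩
  set t : Fin (k + 1) → ℝ := fun i => T.orderEmbOfFin hk i with htdef
  have ht : StrictMono t := fun i j hij => (T.orderEmbOfFin hk).strictMono hij
  have htmem : ∀ i, t i ∈ T := fun i => T.orderEmbOfFin_mem hk i
  obtain ⟨c, hcmono, hcΔ, hc0, hcbetween⟩ := exists_strictMono_deriv_zeros hΔc hG t ht
    (fun i => (hT _ (htmem i)).1) (fun i => (hT _ (htmem i)).2)
  -- the Rolle points are not zeros of `G`
  have hcT : ∀ i, c i ∉ T := by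
    intro i hci
    -- `c i = t j` for some `j`, squeezed strictly between `t i.castSucc` and `t i.succ`
    have hrange : c i ∈ Set.range (T.orderEmbOfFin hk) := by
      rw [Finset.range_orderEmbOfFin, Finset.mem_coe]; exact hci
    obtain ⟨j, hj⟩ := hrange
    have h1 : t i.castSucc < t j := by
      have := (hcbetween i).1
      rw [← hj] at this
      exact this
    have h2 : t j < t i.succ := by
      have := (hcbetween i).2
      rw [← hj] at this
      exact this
    have h1' := ht.lt_iff_lt.mp h1
    have h2' := ht.lt_iff_lt.mp h2
    rw [Fin.lt_def] at h1' h2'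
    simp at h1' h2'
    omega
  have hcZ' : ∀ i, c i ∈ hfin.toFinset := fun i => by
    rw [Set.Finite.mem_toFinset]; exact ⟨hcΔ i, hc0 i⟩
  have hordc : ∀ i, 1 ≤ analyticOrderNatAt (deriv G) (c i) := by
    intro i
    have hne : analyticOrderAt (deriv G) (c i) ≠ ⊤ :=
      analyticOrderAt_ne_top_of_finite_zeros hΔ (hcΔ i) hfin
    have hne0 : analyticOrderAt (deriv G) (c i) ≠ 0 :=
      analyticOrderAt_ne_zero.mpr ⟨(hG _ (hcΔ i)).deriv, hc0 i⟩
    have : (1 : ℕ∞) ≤ analyticOrderAt (deriv G) (c i) := Order.one_le_iff_ne_zero.mpr hne0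
    rw [← Nat.cast_analyticOrderNatAt hne] at this
    exact_mod_cast this
  -- the sum over `Z'` dominates the sum over `(T ∩ Z') ∪ c(univ)`
  have hdisj : Disjoint (T.filter fun y => y ∈ hfin.toFinset) (Finset.univ.image c) := by
    rw [Finset.disjoint_left]
    intro y hy hy'
    obtain ⟨i, -, rfl⟩ := Finset.mem_image.mp hy'
    exact hcT i (Finset.mem_filter.mp hy).1
  have hsub : (T.filter fun y => y ∈ hfin.toFinset) ∪ Finset.univ.image c ⊆ hfin.toFinset := by
    intro y hy
    rcases Finset.mem_union.mp hy with hy | hy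
    · exact (Finset.mem_filter.mp hy).2
    · obtain ⟨i, -, rfl⟩ := Finset.mem_image.mp hy
      exact hcZ' i
  have hmain : (∑ y ∈ T, (analyticOrderNatAt G y - 1)) + k ≤
      ∑ y ∈ hfin.toFinset, analyticOrderNatAt (deriv G) y := by
    calc (∑ y ∈ T, (analyticOrderNatAt G y - 1)) + k
        = (∑ y ∈ T.filter (fun y => y ∈ hfin.toFinset), (analyticOrderNatAt G y - 1)) + k := by
          congr 1
          rw [← Finset.sum_filter_add_sum_filter_not T (fun y => y ∈ hfin.toFinset)]
          have hz : ∑ y ∈ T.filter (fun y => ¬ y ∈ hfin.toFinset), (analyticOrderNatAt G y - 1) = 0 := by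
            refine Finset.sum_eq_zero fun y hy => ?_
            obtain ⟨hyT, hyZ⟩ := Finset.mem_filter.mp hy
            have hyΔ := (hT y hyT).1
            have hd : deriv G y ≠ 0 := by
              intro hd; exact hyZ (by rw [Set.Finite.mem_toFinset]; exact ⟨hyΔ, hd⟩)
            have h1 : analyticOrderAt G y = 1 :=
              (hG y hyΔ).analyticOrderAt_eq_one_of_zero_deriv_ne_zero (hT y hyT).2 hd
            have : analyticOrderNatAt G y = 1 := by
              unfold analyticOrderNatAt; rw [h1]; rfl
            rw [this]
            omega
          rw [hz, add_zero]
      _ ≤ (∑ y ∈ T.filter (fun y => y ∈ hfin.toFinset), analyticOrderNatAt (deriv G) y) +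
            ∑ y ∈ Finset.univ.image c, analyticOrderNatAt (deriv G) y := by
          refine add_le_add (Finset.sum_le_sum fun y hy => ?_) ?_
          · have := hordZ y (Finset.mem_filter.mp hy).1
            omega
          · rw [Finset.sum_image (fun i _ j _ h => hcmono.injective h)]
            calc k = ∑ _i : Fin k, 1 := by simp
              _ ≤ ∑ i : Fin k, analyticOrderNatAt (deriv G) (c i) :=
                  Finset.sum_le_sum fun i _ => hordc i
      _ = ∑ y ∈ (T.filter fun y => y ∈ hfin.toFinset) ∪ Finset.univ.image c,
            analyticOrderNatAt (deriv G) y := (Finset.sum_union hdisj).symm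
      _ ≤ ∑ y ∈ hfin.toFinset, analyticOrderNatAt (deriv G) y :=
          Finset.sum_le_sum_of_subset_of_nonneg hsub fun _ _ _ => Nat.zero_le _
  have hsplit : ∑ y ∈ T, analyticOrderNatAt G y ≤ (∑ y ∈ T, (analyticOrderNatAt G y - 1)) + T.card := by
    rw [Finset.card_eq_sum_ones, ← Finset.sum_add_distrib]
    exact Finset.sum_le_sum fun y _ => by omega
  unfold rootCountMult
  rw [finsum_mem_eq_finite_toFinset_sum _ hZfin, finsum_mem_eq_finite_toFinset_sum _ hfin, ← hTdef]
  omega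

/-! ### Descartes' rule passes to subfamilies -/

/-- The combination with coefficients extended by zero is the combination of the subfamily.
[cite: BihanDickenstein2017, Def. 4.1] -/
theorem linComb_extend {s ℓ : ℕ} (J : Fin ℓ → Fin s) (hJ : Function.Injective J)
    (c : Fin ℓ → ℝ) (h : Fin s → ℝ → ℝ) :
    linComb (Function.extend J c (fun _ => (0 : ℝ))) h = linComb c (fun b => h (J b)) := by
  classical
  funext y
  unfold linComb
  have hsplit : ∑ i, Function.extend J c (fun _ => (0 : ℝ)) i * h i y =
      ∑ i ∈ Finset.univ.image J, Function.extend J c (fun _ => (0 : ℝ)) i * h i y := by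
    rw [← Finset.sum_subset (Finset.subset_univ (Finset.univ.image J))]
    intro i _ hi
    have : ¬ ∃ b, J b = i := by
      intro ⟨b, hb⟩; exact hi (Finset.mem_image.mpr ⟨b, Finset.mem_univ _, hb⟩)
    rw [Function.extend_apply' c _ i this]
    simp
  rw [hsplit, Finset.sum_image (fun b _ b' _ hbb' => hJ hbb')]
  refine Finset.sum_congr rfl fun b _ => ?_
  rw [hJ.extend_apply]

/-- **Descartes' rule passes to subfamilies** (used in Pólya–Szegő solution 87, "cf. (1)"): if
`(h_1, …, h_s)` satisfies Descartes' rule of signs on `Δ`, so does every increasing subfamily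
`(h_{j_1}, …, h_{j_ℓ})`. [cite: PolyaSzego1998, Part V §7 solution 87] -/
theorem satisfiesDescartesRule_comp_strictMono {s ℓ : ℕ} {h : Fin s → ℝ → ℝ} {Δ : Set ℝ}
    (hD : SatisfiesDescartesRule h Δ) (J : Fin ℓ → Fin s) (hJ : StrictMono J) :
    SatisfiesDescartesRule (fun b => h (J b)) Δ := by
  intro c hc
  have ha : Function.extend J c (fun _ => (0 : ℝ)) ≠ 0 := by
    intro h0
    apply hc
    funext b
    have := congrFun h0 (J b)
    rwa [hJ.injective.extend_apply] at this
  obtain ⟨hfin, hle⟩ := hD (Function.extend J c (fun _ => (0 : ℝ))) ha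
  rw [linComb_extend J hJ.injective c h] at hfin hle
  rw [signVar_ofFn_extend J hJ c] at hle
  exact ⟨hfin, hle⟩

end BD17

end Literature.Computability.AlgebraicComplexity
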